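import Summits.CriticalPhenomena.PercolationContinuityZ3.Theses.PercLowPointHalfSpace
import Summits.CriticalPhenomena.PercolationContinuityZ3.Theses.PercNonProliferation
import Summits.CriticalPhenomena.PercolationContinuityZ3.Theorems.BoundaryTwoArmDecay.Negative.LoadBearing
import Summits.CriticalPhenomena.PercolationContinuityZ3.Theorems.PercLowPointHalfSpaceBoundaryTwoArmDecayStubReach
import Summits.CriticalPhenomena.PercolationContinuityZ3.Theorems.PercLowPointHalfSpaceBoundaryTwoArmDecayStubStep
import Summits.CriticalPhenomena.PercolationContinuityZ3.Theorems.PercLowPointHalfSpaceBoundaryTwoArmDecayStubCensus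
import Summits.CriticalPhenomena.PercolationContinuityZ3.Theorems.PercLowPointHalfSpaceBoundaryTwoArmDecayStubTallDensity

/-!
# Crux `PercLowPointHalfSpace.BoundaryTwoArmDecay` (stmt-CriticalPhenomena-0911), line
# `staircase-bootstrap-floor-decoupling` — the CONDITIONAL REDUCTION of the crux to the line's three open inputs

Lead file of the line (prover-line-stmt-CriticalPhenomena-0911-a5-0).  The skeleton
`Cruxes/BoundaryTwoArmDecay/Lines/staircase_bootstrap_floor_decoupling.lean` has seven registered stubs; four of them
are THEOREMS of the tree now —

* `stub_census`      (`…StubCensus.lean`, p132078): the truncated level census `P(A_n ∧ K_n ≤ k) ≤ (2/p_c³)·k·e_n`;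
* `stub_tallDensity` (`…StubTallDensity.lean`, p131461): `SubpolynomialBlocking → ∀ s > 0, ν_n ≤ C_s n^{s-2}`;
* `stub_step`        (`…StubStep.lean`, p131732): one round `a ↦ 3 - σ - max 0 (2 - a)` of the vertical bootstrap;
* `stub_reach`       (`…StubReach.lean`, p130902): vertical exponent `a` ⇒ sup-norm exponent `b` whenever `b·A < a`,

so the kernel-checked composition `BoundaryTwoArmDecay_of` of the skeleton collapses to the implication proved here
(`stub_staircaseReduction`, registered on the item as a sub-goal so that it can land `--supports`):

  `FloorDecoupling (Q) → Confinement (Q_conf) → SlabCrossover(A) for some A ∈ [1, 6/5) → SubpolynomialBlocking → BoundaryTwoArmDecay`.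

The three remaining hypotheses are exactly the line's OPEN inputs, stated verbatim as the registered stubs
`stub_floorDecoupling` (Q, a new conjecture: upper quasi-independence of boundary two-arm events at separated floor
roots), `stub_confinement` (Q_conf, a new conjecture: confinement of the kissing wall cluster in probability) and
`stub_slab` (the sibling crux stmt-CriticalPhenomena-6700 `PercDivergentSlabLadder.SlabCrossoverPolynomial` with its
exponent capped below `6/5`); the fourth is the tagged sibling crux stmt-CriticalPhenomena-4446 by name.  Nothing here
claims any of them: this file records, sorry-free, that crux A of route `PercLowPointHalfSpace` is now CONDITIONAL on
{Q, Q_conf, 6700⁺, 4446} and on nothing else.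

## The arithmetic (the skeleton's glue, replayed against the landed theorems)

From the trivial seed `a₀ = 0` three rounds of `stub_step` give the vertical exponent `3 - 3σ` for every `σ ∈ (0,1]`;
with the slab exponent `A ∈ [1, 6/5)` choose `σ = (6 - 5A)/16` and `b = 13/4 - 5A/8 > 5/2`: then
`b·A < 3 - 3σ ⟺ (6/5 - A)(5/2 - A) > 0`, so `stub_reach` gives `P(E_r) ≤ C r^{-b}` and `κ := b - 5/2 > 0`.
-/

noncomputable section

namespace Summit.CriticalPhenomena.PercolationContinuityZ3.Theorems.BoundaryTwoArmDecay

open MeasureTheory Filter Topology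
open Literature.Probability.Percolation Literature.Probability.LatticeModels
open Summit.CriticalPhenomena.PercolationContinuityZ3.Theses.PercLowPointHalfSpace (BoundaryTwoArmDecay)

open Negative (μ E boundaryTwoArmDecay_iff)
open StubStep (kissV)

namespace StaircaseReduction

/-! ### The a-priori vertical bound `P(kissV n 0 1) ≤ C n^{-a}` and the staircase -/

/-- The trivial seed: probabilities are at most `1 = n^0`. -/
theorem aprioriV_zero :
    ∃ C : ℝ, ∀ n : ℕ, 1 ≤ n → μ.real (kissV n 0 1) ≤ C * (n : ℝ) ^ (-(0 : ℝ)) := by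
  refine ⟨1, fun n _ => ?_⟩
  rw [neg_zero, Real.rpow_zero, mul_one]
  exact measureReal_le_one

/-- Monotonicity of the a-priori vertical bound in the exponent. -/
theorem aprioriV_mono {a a' : ℝ} (h : a' ≤ a)
    (ha : ∃ C : ℝ, ∀ n : ℕ, 1 ≤ n → μ.real (kissV n 0 1) ≤ C * (n : ℝ) ^ (-a)) :
    ∃ C : ℝ, ∀ n : ℕ, 1 ≤ n → μ.real (kissV n 0 1) ≤ C * (n : ℝ) ^ (-a') := by
  obtain ⟨C, hC⟩ := ha
  refine ⟨max C 0, fun n hn => ?_⟩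
  have hn1 : (1 : ℝ) ≤ n := by exact_mod_cast hn
  calc μ.real (kissV n 0 1) ≤ C * (n : ℝ) ^ (-a) := hC n hn
    _ ≤ max C 0 * (n : ℝ) ^ (-a) :=
        mul_le_mul_of_nonneg_right (le_max_left _ _) (Real.rpow_nonneg (by linarith) _)
    _ ≤ max C 0 * (n : ℝ) ^ (-a') :=
        mul_le_mul_of_nonneg_left (Real.rpow_le_rpow_of_exponent_le hn1 (by linarith)) (le_max_right _ _)

/-- Three rounds of the staircase from the trivial seed, given ONE ROUND as a hypothesis:
`0 ↦ 1 - σ ↦ 2 - 2σ ↦ 3 - 3σ` for every `σ ∈ (0, 1]`. -/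
theorem three_rounds
    (hS : ∀ a : ℝ, 0 ≤ a →
      (∃ C : ℝ, ∀ n : ℕ, 1 ≤ n → μ.real (kissV n 0 1) ≤ C * (n : ℝ) ^ (-a)) →
      ∀ σ : ℝ, 0 < σ →
        ∃ C : ℝ, ∀ n : ℕ, 1 ≤ n → μ.real (kissV n 0 1) ≤ C * (n : ℝ) ^ (-(3 - σ - max 0 (2 - a))))
    {σ : ℝ} (hσ : 0 < σ) (hσ1 : σ ≤ 1) :
    ∃ C : ℝ, ∀ n : ℕ, 1 ≤ n → μ.real (kissV n 0 1) ≤ C * (n : ℝ) ^ (-(3 - 3 * σ)) := by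
  -- round 1: a = 0 ↦ 1 - σ
  have h1 : ∃ C : ℝ, ∀ n : ℕ, 1 ≤ n → μ.real (kissV n 0 1) ≤ C * (n : ℝ) ^ (-(1 - σ)) := by
    have := hS 0 le_rfl aprioriV_zero σ hσ
    have hmax : max 0 (2 - (0 : ℝ)) = 2 := by rw [sub_zero, max_eq_right (by norm_num : (0 : ℝ) ≤ 2)]
    rw [hmax] at this
    exact aprioriV_mono (by linarith) this
  -- round 2: a = 1 - σ ↦ 2 - 2σ
  have h2 : ∃ C : ℝ, ∀ n : ℕ, 1 ≤ n → μ.real (kissV n 0 1) ≤ C * (n : ℝ) ^ (-(2 - 2 * σ)) := by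
    have := hS (1 - σ) (by linarith) h1 σ hσ
    have hmax : max 0 (2 - (1 - σ)) = 1 + σ := by rw [max_eq_right (by linarith)]; ring
    rw [hmax] at this
    exact aprioriV_mono (by linarith) this
  -- round 3: a = 2 - 2σ ↦ 3 - 3σ
  have := hS (2 - 2 * σ) (by linarith) h2 σ hσ
  have hmax : max 0 (2 - (2 - 2 * σ)) = 2 * σ := by rw [max_eq_right (by linarith)]; ring
  rw [hmax] at this
  exact aprioriV_mono (by linarith) this

end StaircaseReduction

open StaircaseReduction in
/-- **Conditional reduction of crux A** (registered sub-goal `stub_staircaseReduction` of stmt-CriticalPhenomena-0911,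
line `staircase-bootstrap-floor-decoupling`): the line's three OPEN inputs — floor decoupling (Q), confinement
(Q_conf), polynomial slab crossover with exponent `A ∈ [1, 6/5)` (stmt-6700 strengthened) — together with the tagged
sibling crux `SubpolynomialBlocking` (stmt-4446) imply `BoundaryTwoArmDecay`.  Proof: the landed stubs
`stub_census`, `stub_tallDensity`, `stub_step`, `stub_reach` and the staircase arithmetic
(`σ = (6 - 5A)/16`, three rounds, `b = 13/4 - 5A/8`, `κ = b - 5/2`). -/
theorem stub_staircaseReduction :
    (∃ C : ℝ, ∃ d₀ : ℕ, ∀ (j : Fin 3) (n m : ℕ) (x : Site 3), j ≠ 0 → x 0 = 0 → d₀ ≤ m → m ≤ n →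
      3 * m ≤ max (x 1).natAbs (x 2).natAbs →
        (bondPercolation (zdGraph 3) (criticalProbI 3)).real
            ({ω | (∃ y : Site 3, (n : ℤ) ≤ y 0 ∧ ω ∈ openConnIn (halfSpace 3) 0 y) ∧
                (∃ y : Site 3, (n : ℤ) ≤ y 0 ∧ ω ∈ openConnIn (halfSpace 3) ((0 : Site 3) + Pi.single 1 1) y) ∧
                ω ∉ openConnIn (halfSpace 3) 0 ((0 : Site 3) + Pi.single 1 1)} ∩
              {ω | (∃ y : Site 3, (m : ℤ) ≤ y 0 ∧ ω ∈ openConnIn (halfSpace 3) x y) ∧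
                (∃ y : Site 3, (m : ℤ) ≤ y 0 ∧ ω ∈ openConnIn (halfSpace 3) (x + Pi.single j 1) y) ∧
                ω ∉ openConnIn (halfSpace 3) x (x + Pi.single j 1)}) ≤
          C * (bondPercolation (zdGraph 3) (criticalProbI 3)).real
              {ω | (∃ y : Site 3, (n : ℤ) ≤ y 0 ∧ ω ∈ openConnIn (halfSpace 3) 0 y) ∧
                (∃ y : Site 3, (n : ℤ) ≤ y 0 ∧ ω ∈ openConnIn (halfSpace 3) ((0 : Site 3) + Pi.single 1 1) y) ∧
                ω ∉ openConnIn (halfSpace 3) 0 ((0 : Site 3) + Pi.single 1 1)} *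
            (bondPercolation (zdGraph 3) (criticalProbI 3)).real
              {ω | (∃ y : Site 3, (m : ℤ) ≤ y 0 ∧ ω ∈ openConnIn (halfSpace 3) x y) ∧
                (∃ y : Site 3, (m : ℤ) ≤ y 0 ∧ ω ∈ openConnIn (halfSpace 3) (x + Pi.single j 1) y) ∧
                ω ∉ openConnIn (halfSpace 3) x (x + Pi.single j 1)}) →
    (∀ s : ℝ, 0 < s → ∀ᶠ n : ℕ in Filter.atTop,
      (n : ℝ) ^ (-s) *
          (bondPercolation (zdGraph 3) (criticalProbI 3)).real
            {ω | (∃ y : Site 3, (n : ℤ) ≤ y 0 ∧ ω ∈ openConnIn (halfSpace 3) 0 y) ∧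
              (∃ y : Site 3, (n : ℤ) ≤ y 0 ∧ ω ∈ openConnIn (halfSpace 3) ((0 : Site 3) + Pi.single 1 1) y) ∧
              ω ∉ openConnIn (halfSpace 3) 0 ((0 : Site 3) + Pi.single 1 1)} ≤
        (bondPercolation (zdGraph 3) (criticalProbI 3)).real
          ({ω | (∃ y : Site 3, (n : ℤ) ≤ y 0 ∧ ω ∈ openConnIn (halfSpace 3) 0 y) ∧
              (∃ y : Site 3, (n : ℤ) ≤ y 0 ∧ ω ∈ openConnIn (halfSpace 3) ((0 : Site 3) + Pi.single 1 1) y) ∧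
              ω ∉ openConnIn (halfSpace 3) 0 ((0 : Site 3) + Pi.single 1 1)} ∩
            {ω | ∀ y : Site 3, ω ∈ openConnIn (halfSpace 3) 0 y → ∀ i : Fin 3, |y i| < ((3 * n : ℕ) : ℤ)})) →
    (∃ A : ℝ, 1 ≤ A ∧ A < 6 / 5 ∧ ∃ C : ℝ, 0 < C ∧ ∀ k n : ℕ, 1 ≤ k → ∀ x : Site 3,
      (bondPercolation (zdGraph 3) (criticalProbI 3)).real
          {ω | ∃ y : Site 3, (n : ℤ) ≤ max |y 1 - x 1| |y 2 - x 2| ∧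
            ω ∈ openConnIn {z : Site 3 | |z 0| ≤ (k : ℤ)} x y} ≤
        C * (k : ℝ) ^ C * Real.exp (-((n : ℝ) / (C * (k : ℝ) ^ A)))) →
    Summit.CriticalPhenomena.PercolationContinuityZ3.Theses.PercNonProliferation.SubpolynomialBlocking →
      Summit.CriticalPhenomena.PercolationContinuityZ3.Theses.PercLowPointHalfSpace.BoundaryTwoArmDecay := by
  intro hQ hConf hSlab hB
  -- one round of the staircase, fed by the census, the tall density (from 4446), Q and Q_conf
  have hS : ∀ a : ℝ, 0 ≤ a →
      (∃ C : ℝ, ∀ n : ℕ, 1 ≤ n → μ.real (kissV n 0 1) ≤ C * (n : ℝ) ^ (-a)) →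
      ∀ σ : ℝ, 0 < σ →
        ∃ C : ℝ, ∀ n : ℕ, 1 ≤ n → μ.real (kissV n 0 1) ≤ C * (n : ℝ) ^ (-(3 - σ - max 0 (2 - a))) :=
    stub_step stub_census (stub_tallDensity hB) hQ hConf
  -- the slab exponent A ∈ [1, 6/5) fixes the losses
  obtain ⟨A, hA1, hA65, hSlabA⟩ := hSlab
  set σ : ℝ := (6 - 5 * A) / 16 with hσdef
  have hσ : 0 < σ := by rw [hσdef]; linarith
  have hσ1 : σ ≤ 1 := by rw [hσdef]; linarith
  -- three rounds: vertical exponent 3 - 3σ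
  have hV := three_rounds hS hσ hσ1
  -- reach: sup exponent b = 13/4 - 5A/8 > 5/2, admissible since bA < 3 - 3σ ⟺ (6/5 - A)(5/2 - A) > 0
  set b : ℝ := 13 / 4 - 5 * A / 8 with hbdef
  have hb52 : (5 : ℝ) / 2 < b := by rw [hbdef]; linarith
  have hb : 0 < b := by linarith
  have hbA : b * A < 3 - 3 * σ := by
    rw [hbdef, hσdef]
    nlinarith [mul_pos (sub_pos.2 hA65) (sub_pos.2 (show A < 5 / 2 by linarith))]
  obtain ⟨C, hC⟩ := stub_reach A hA1 hSlabA (3 - 3 * σ) b hb hbA hV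
  -- κ = b - 5/2
  rw [boundaryTwoArmDecay_iff]
  refine ⟨b - 5 / 2, C, by linarith, fun r hr => ?_⟩
  have hexp : (-(5 / 2 + (b - 5 / 2)) : ℝ) = -b := by ring
  rw [hexp]
  exact hC r hr

end Summit.CriticalPhenomena.PercolationContinuityZ3.Theorems.BoundaryTwoArmDecay

end
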